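/-
Copyright (c) 2026 the pub-hodgecm-mathlib formalisation cell (harness21).  Prover seat hodgecm-mathlib-R90-C10-p06 (g3), R90-TF SLAB section S1 «Ch10-local» (base
R90-C10), h413 = `stmt-HodgeConjecture-24833`; line «B_pos», RAMIFIED corner (B-10) (census `R90/R90-C10-p08/g2/CENSUS-Bpos-ramified-posdepth.md` 3c8eaa3bd4b223c1 §2 (c),
S1 chair R90-C10-plan (g2) 00:25Z DEFAULTS (iii)): brick (B-10)(4) «CONDUCTOR PARITY (P)» — at a TAME RAMIFIED place, a character trivial on the `σ`-fixed principal units has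
an EVEN conductor exponent.  2026-09-05.
-/
import Summits.HodgeConjecture.HodgeConjecture.Theorems.K2E3ConcaveLevelIwahoriCharacterCM   -- ★ p862709 (K2E3-p34 (g2)): `isUnit_update_of_ne_zero`, `conjLocal_update_fixed` (the one-place unit of `L ⊗ L⁺_v` and its `(c ⊗ 1)`-invariance); brings the CM frame
import Literature.NumberTheory.Automorphic.RamifiedPlaceResidueApproximation              -- ★ `exists_valued_sub_toPlace_lt_one_of_ne_one` (`f(w|v) = 1`: residue approximation along `ι_w`); brings ★ `valued_toPlace_eq_pow_two_of_ramified`, ★ `toPlace`, ★ `galAdicCompletionMap_toPlace`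
import Literature.NumberTheory.Automorphic.HermitianLatticesLocal                          -- ★ `HermitianLattice.v_lt_one_iff` (discreteness `|x| < 1 ↔ |x| ≤ |ϖ|`)
import HarnessLib

/-!
# R90-TF S1 «Ch10-local» ∕ K2 E3 «U4Keys» :182, BRANCH B AT POSITIVE DEPTH, RAMIFIED corner — brick (B-10)(4): CONDUCTOR PARITY
# «at a ramified non-split place `w ∣ v`, a character `χ₁` of `(L ⊗ L⁺_v)ˣ` trivial on the `σ`-fixed principal units, of conductor exponent `m + 1 ≥ 2`
# (trivial at level `ϖ^{m+1}`, non-trivial at level `ϖ^m`), has `m` ODD, i.e. `cond_E χ₁ = m + 1` EVEN»   [Serre1979 Ch. IV §1, Ch. V §3; NeukirchANT1999 Ch. II §4; Keys1984 §7 Thm (2)]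

Cell `pub/hodgecm-mathlib`, crux H413 = `stmt-HodgeConjecture-24833`, route of record `HCCMUnconditional` (no route verbs); R90-TF section S1 (junction socket A2′ = U4Keys :217,
REL over :155 and :182).  THEOREMS ONLY (no `def`, no `instance`, no `notation`, no named-fact hypothesis, no `sorry`); lane `--supports stmt-HodgeConjecture-24833 --as helper`,
count-neutral.  NOT THE PAYER of :182.  FRAME: the place letters `(L v) (w hw)` of the B_pos files, the ramification selector `he : e(w ∣ v) ≠ 1` (tree spelling of ★
`valued_toPlace_eq_pow_two_of_ramified` ∕ ★ `exists_valued_sub_toPlace_lt_one_of_ne_one`), a uniformiser `ϖ` of `L_w` (`hϖ`), and the CONDUCTOR LETTERS of ★ p862772 ∕ (B-4) VERBATIM: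
`hcond` at level `Valued.v ϖ ^ (m + 1)`, the witness `u₁` at level `Valued.v ϖ ^ m` with `χ₁ u₁ ≠ 1`, `1 ≤ m`.  The Branch-B input is carried HYPOTHESIS-FIRST as the letter
`hfixP` «`χ₁ u = 1` for every unit `u` of `L ⊗ L⁺_v` with `|u_{w′} − 1| < 1` at every `w′` and `(c ⊗ 1) u = u`» (= the head of p08 (g2)'s (B-10)(1)
`R90S1BposRamFixedPrincipalUnits :: apply_eq_one_of_branchB_of_fixed_principal_ram`, binder shape of ★ (B-4)'s `hfix` with «`|u_{w′}| = 1`» replaced by «`|u_{w′} − 1| < 1`»; at a tame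
ramified place it follows from `hB` alone by Hensel — census §2 (a)).  NO `h2w` here: the parity argument itself is tame-free; tameness enters only through the discharge of `hfixP`.

THE POINT (census §2 (c), audit1 re-derivation 2026-09-05T00:18:31Z).  Suppose `m = 2j` (`j ≥ 1`).  Put `t := ϖ·σ_w ϖ` (`σ_w`-fixed, `|t| = |ϖ|²`) and `a := (u₁)_w`, so
`x := (a − 1)∕t^j` is integral (`|a − 1| ≤ |ϖ|^{2j} = |t^j|`).  Since `f(w ∣ v) = 1` (★ `exists_valued_sub_toPlace_lt_one_of_ne_one`) there is `y ∈ L⁺_v`, `|y| ≤ 1`, with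
`|x − ι_w y| < 1`, hence `≤ |ϖ|` (★ `v_lt_one_iff`).  The element `f := 1 + t^j·ι_w y` is `σ_w`-fixed (★ `galAdicCompletionMap_toPlace`) with `|f − 1| ≤ |ϖ|^{2j} < 1`; its one-place unit
`F` of `L ⊗ L⁺_v` (★ `isUnit_update_of_ne_zero`, `(c ⊗ 1)`-fixed ★ `conjLocal_update_fixed`) is killed by `hfixP`, and `u₁·F⁻¹` has `w`-component `a f⁻¹` with
`a f⁻¹ − 1 = t^j (x − ι_w y) f⁻¹`, `|·| ≤ |ϖ|^{2j}·|ϖ| = |ϖ|^{m+1}`, so `hcond` kills it; hence `χ₁ u₁ = χ₁(u₁F⁻¹)·χ₁(F) = 1`, contradicting `hχu₁`.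
* **`odd_of_conductorLetters_of_fixedPrincipal`** — `Odd m`; **`even_succ_of_conductorLetters_of_fixedPrincipal`** — `Even (m + 1)` (the consumer's `n = 2ν`).
HONEST LABEL.  HC_CM is proved only modulo the 7 printed citations (2 remaining named inputs: hLiu418 = `stmt-HodgeConjecture-24832`, h413 = `stmt-HodgeConjecture-24833`) until rung 0
closes; count-neutral — this file does NOT pay :182 or A2′; no printed citation is discharged; the wild ramified corner is not addressed (there `hfixP` is not dischargeable from `hB`).

## References
* [Serre1979] J.-P. Serre, *Local Fields*, GTM 67 (1979), Ch. IV §1 Prop. 2 (the filtration `U^{(i)}` and `U^{(i)}∕U^{(i+1)} ≅ 𝓀`), Ch. V §3 (norm groups of a totally ramified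
  extension: `N(U_E^{(ψ(i))})` and the `σ`-fixed units).
* [NeukirchANT1999] J. Neukirch, *Algebraic Number Theory*, Grundlehren 322 (1999), Ch. I §8 Prop. (8.2), Ch. II §4 Prop. (4.3) (`e·f = 2`, so `f(w|v) = 1` at a ramified place of a
  quadratic extension; completions).
* [Keys1984] D. Keys, *Principal series representations of special unitary groups over local fields*, Compositio Math. 51 (1984), §7 Theorem (2) p. 126 (the ramified case (d)).
-/

set_option autoImplicit false
-- the mandated namespace has the single-problem summit's repeated segment (`HodgeConjecture.HodgeConjecture`)
set_option linter.dupNamespace false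

noncomputable section

open NumberField IsDedekindDomain
open scoped Matrix MatrixGroups WithZero Valued
open Literature.NumberTheory Literature.NumberTheory.Automorphic Literature.NumberTheory.Automorphic.UnitaryGroup
open Literature.NumberTheory.Rogawski1990

namespace Summit.HodgeConjecture.HodgeConjecture.R90.S1.BposRamConductorEven

open Summit.HodgeConjecture.HodgeConjecture.Cruxes.H413
open Summit.HodgeConjecture.HodgeConjecture.Cruxes.H413.K2E3ConcaveLevelIwahoriCharacterCM

variable (L : Type) [Field L] [NumberField L] [IsCMField L] (v : HeightOneSpectrum (𝓞 ↥(maximalRealSubfield L)))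
  (w : PlacesOver L v) (hw : IsCMField.complexConj L • w.1 = w.1)

open Classical in
include hw in
/-- **CONDUCTOR PARITY AT A RAMIFIED PLACE: `m` IS ODD.**  At a ramified non-split place `w ∣ v` of the CM extension `L ∕ L⁺` (`hw`, `he : e(w ∣ v) ≠ 1`), with `ϖ` a uniformiser of
`L_w`, let `χ₁ : (L ⊗ L⁺_v)ˣ → ℂˣ` be trivial on the `σ`-fixed principal units (`hfixP`: `|u_{w′} − 1| < 1` at every `w′` and `(c ⊗ 1) u = u` ⟹ `χ₁ u = 1`), trivial at level `ϖ^{m+1}`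
(`hcond`) and non-trivial at level `ϖ^m` (witness `u₁`, `hu₁`, `hχu₁`), `1 ≤ m`.  Then `m` is ODD (the conductor exponent `m + 1` is even).  Proof: if `m = 2j`, residue approximation
along `ι_w` (`f(w ∣ v) = 1`, ★ `exists_valued_sub_toPlace_lt_one_of_ne_one`) writes `(u₁)_w ≡ 1 + (ϖσϖ)^j·ι_w y (mod 𝔭_w^{m+1})` with `1 + (ϖσϖ)^j ι_w y` a `σ`-fixed principal unit,
so `hfixP` and `hcond` force `χ₁ u₁ = 1`. [cite: Serre1979, Ch. IV §1 Prop. 2; Ch. V §3] [cite: NeukirchANT1999, Ch. II §4 Prop. (4.3)] [cite: Keys1984, §7 Theorem (2) p. 126] -/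
theorem odd_of_conductorLetters_of_fixedPrincipal (he : v.asIdeal.ramificationIdx' w.1.asIdeal ≠ 1)
    {ϖ : w.1.adicCompletion L} (hϖ : Valued.v ϖ = WithZero.exp (-1 : ℤ)) (χ₁ : (LocalRing L v)ˣ →* ℂˣ)
    (hfixP : ∀ u : (LocalRing L v)ˣ, (∀ w' : PlacesOver L v, Valued.v (((u : LocalRing L v) w') - 1) < 1) →
      conjLocal L (IsCMField.complexConj L) v (u : LocalRing L v) = u → χ₁ u = 1)
    {m : ℕ} (hm : 1 ≤ m)
    (hcond : ∀ u : (LocalRing L v)ˣ, (∀ w' : PlacesOver L v, Valued.v (((u : LocalRing L v) w') - 1) ≤ Valued.v ϖ ^ (m + 1)) → χ₁ u = 1)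
    (u₁ : (LocalRing L v)ˣ) (hu₁ : ∀ w' : PlacesOver L v, Valued.v (((u₁ : LocalRing L v) w') - 1) ≤ Valued.v ϖ ^ m) (hχu₁ : χ₁ u₁ ≠ 1) :
    Odd m := by
  haveI : Algebra.IsQuadraticExtension ↥(maximalRealSubfield L) L := IsCMField.isQuadraticExtension L
  rcases Nat.even_or_odd m with ⟨j, hj⟩ | hodd
  swap
  · exact hodd
  exfalso
  -- abbreviations at the place `w`
  have hσσ : ∀ x, (galAdicCompletionMap (L := L) (IsCMField.complexConj L) hw) ((galAdicCompletionMap (L := L) (IsCMField.complexConj L) hw) x) = x :=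
    galAdicCompletionMap_galAdicCompletionMap_of_smul_eq (IsCMField.complexConj L) w (IsCMField.complexConj_ne_one L) hw
  have hvσ : ∀ x, Valued.v (galAdicCompletionMap (L := L) (IsCMField.complexConj L) hw x) = Valued.v x :=
    fun x => valued_galAdicCompletionMap (L := L) (IsCMField.complexConj L) hw x
  have hϖ0 : ϖ ≠ 0 := CartanUnique.uniformizer_ne_zero hϖ
  have hvϖ1 : Valued.v ϖ < 1 := by rw [hϖ, ← WithZero.exp_zero, WithZero.exp_lt_exp]; norm_num
  have hvϖm : Valued.v ϖ ^ m < 1 := pow_lt_one' hvϖ1 (Nat.one_le_iff_ne_zero.1 hm)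
  -- `t := ϖ · σϖ`: `σ`-fixed, `|t| = |ϖ|²`, `|t^j| = |ϖ|^m`
  set t : w.1.adicCompletion L := ϖ * galAdicCompletionMap (L := L) (IsCMField.complexConj L) hw ϖ with ht
  have hσt : galAdicCompletionMap (L := L) (IsCMField.complexConj L) hw t = t := by rw [ht, map_mul, hσσ, mul_comm]
  have hvtj : Valued.v (t ^ j) = Valued.v ϖ ^ m := by
    rw [map_pow, ht, map_mul, hvσ, hj, ← two_mul, pow_mul, sq]
  have htj0 : t ^ j ≠ 0 := fun h => by
    rw [h, map_zero] at hvtj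
    exact (pow_ne_zero m ((Valuation.ne_zero_iff _).2 hϖ0)) hvtj.symm
  have hvtj0 : 0 < Valued.v (t ^ j) := by rw [hvtj]; exact pow_pos ((Valuation.pos_iff _).2 hϖ0) m
  -- `a := (u₁)_w`, `x := (a − 1) ∕ t^j` is integral
  set a : w.1.adicCompletion L := (u₁ : LocalRing L v) w with ha
  set x : w.1.adicCompletion L := (a - 1) / t ^ j with hx
  have hvx : Valued.v x ≤ 1 := by
    rw [hx, map_div₀, div_le_one₀ hvtj0, hvtj]
    exact hu₁ w
  -- residue approximation along `ι_w` (`f(w|v) = 1`)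
  obtain ⟨y, hy1, hxy⟩ := exists_valued_sub_toPlace_lt_one_of_ne_one L (IsCMField.complexConj L) v w (IsCMField.complexConj_ne_one L) hw he x hvx
  have hxy' : Valued.v (x - toPlace v w y) ≤ Valued.v ϖ := by
    rw [hϖ]; exact (HermitianLattice.v_lt_one_iff _).1 hxy
  have hvιy : Valued.v (toPlace v w y) ≤ 1 := by
    rw [valued_toPlace_eq_pow_two_of_ramified (IsCMField.complexConj L) w (IsCMField.complexConj_ne_one L) hw he y]
    exact pow_le_one₀ zero_le hy1
  -- the `σ`-fixed principal unit `f := 1 + t^j · ι_w y`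
  set f : w.1.adicCompletion L := 1 + t ^ j * toPlace v w y with hf
  have hσf : galAdicCompletionMap (L := L) (IsCMField.complexConj L) hw f = f := by
    rw [hf, map_add, map_one, map_mul, map_pow, hσt, galAdicCompletionMap_toPlace (IsCMField.complexConj L) w w hw y]
  have hvf1 : Valued.v (f - 1) ≤ Valued.v ϖ ^ m := by
    rw [hf, add_sub_cancel_left, map_mul, hvtj]
    exact mul_le_of_le_one_right' hvιy
  have hvf1' : Valued.v (f - 1) < 1 := hvf1.trans_lt hvϖm
  have hvf : Valued.v f = 1 := by
    have h := Valued.v.map_one_add_of_lt hvf1'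
    rwa [add_sub_cancel] at h
  have hf0 : f ≠ 0 := fun h => by rw [h, map_zero] at hvf; exact zero_ne_one hvf
  -- its one-place unit `F` of `L ⊗ L⁺_v`, killed by `hfixP`
  have hFU := isUnit_update_of_ne_zero L v w hw hf0
  have hχF : χ₁ hFU.unit = 1 := by
    refine hfixP _ (fun w' => ?_) ?_
    · obtain rfl := PlacesOver.eq_of_smul_eq (IsCMField.complexConj L) (IsCMField.complexConj_ne_one L) w hw w'
      rw [IsUnit.unit_spec, Function.update_self]
      exact hvf1'
    · have h := congrArg Units.val (conjLocal_update_fixed L v w hw hf0 hσf)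
      rwa [Units.coe_map, MonoidHom.coe_coe] at h
  -- `u₁ · F⁻¹ ≡ 1 (mod 𝔭^{m+1})`, killed by `hcond`
  have htx : t ^ j * x = a - 1 := by
    rw [hx]
    field_simp
  have hxf : t ^ j * (x - toPlace v w y) = a - f := by
    rw [mul_sub, htx, hf]
    ring
  have hkey : ((u₁ * hFU.unit⁻¹ : (LocalRing L v)ˣ) : LocalRing L v) w - 1 = t ^ j * (x - toPlace v w y) * f⁻¹ := by
    rw [hxf, sub_mul, mul_inv_cancel₀ hf0, Units.val_mul, Units.val_inv_eq_inv_val, IsUnit.unit_spec, Pi.mul_apply, Pi.inv_apply, Function.update_self, ← ha]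
  have hbound : Valued.v (((u₁ * hFU.unit⁻¹ : (LocalRing L v)ˣ) : LocalRing L v) w - 1) ≤ Valued.v ϖ ^ (m + 1) := by
    rw [hkey, map_mul, map_mul, map_inv₀, hvf, inv_one, mul_one, hvtj, pow_succ]
    exact mul_le_mul_right hxy' _
  have hχq : χ₁ (u₁ * hFU.unit⁻¹) = 1 := by
    refine hcond _ fun w' => ?_
    obtain rfl := PlacesOver.eq_of_smul_eq (IsCMField.complexConj L) (IsCMField.complexConj_ne_one L) w hw w'
    exact hbound
  -- contradiction
  apply hχu₁
  calc χ₁ u₁ = χ₁ (u₁ * hFU.unit⁻¹) * χ₁ hFU.unit := by rw [← map_mul, inv_mul_cancel_right]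
    _ = 1 := by rw [hχq, hχF, one_mul]

open Classical in
include hw in
/-- **CONDUCTOR PARITY, consumer's form: `m + 1` IS EVEN** (`cond_E χ₁ = 2ν`) — same letters as `odd_of_conductorLetters_of_fixedPrincipal`. [cite: Serre1979, Ch. V §3]
[cite: Keys1984, §7 Theorem (2) p. 126] -/
theorem even_succ_of_conductorLetters_of_fixedPrincipal (he : v.asIdeal.ramificationIdx' w.1.asIdeal ≠ 1)
    {ϖ : w.1.adicCompletion L} (hϖ : Valued.v ϖ = WithZero.exp (-1 : ℤ)) (χ₁ : (LocalRing L v)ˣ →* ℂˣ)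
    (hfixP : ∀ u : (LocalRing L v)ˣ, (∀ w' : PlacesOver L v, Valued.v (((u : LocalRing L v) w') - 1) < 1) →
      conjLocal L (IsCMField.complexConj L) v (u : LocalRing L v) = u → χ₁ u = 1)
    {m : ℕ} (hm : 1 ≤ m)
    (hcond : ∀ u : (LocalRing L v)ˣ, (∀ w' : PlacesOver L v, Valued.v (((u : LocalRing L v) w') - 1) ≤ Valued.v ϖ ^ (m + 1)) → χ₁ u = 1)
    (u₁ : (LocalRing L v)ˣ) (hu₁ : ∀ w' : PlacesOver L v, Valued.v (((u₁ : LocalRing L v) w') - 1) ≤ Valued.v ϖ ^ m) (hχu₁ : χ₁ u₁ ≠ 1) :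
    Even (m + 1) :=
  (odd_of_conductorLetters_of_fixedPrincipal L v w hw he hϖ χ₁ hfixP hm hcond u₁ hu₁ hχu₁).add_one

end Summit.HodgeConjecture.HodgeConjecture.R90.S1.BposRamConductorEven

end
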